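import Summits.FinalStateConjecture.FinalStateConjecture.Theses.PhaseMixingCapture
import Summits.FinalStateConjecture.FinalStateConjecture.Theses.SwallowTheDatum
import Summits.FinalStateConjecture.FinalStateConjecture.Theorems.BulkKerrCapture.Negative.SpinGapAndMass
import Summits.FinalStateConjecture.FinalStateConjecture.Theorems.KerrShieldedDataExist.Negative.SliceClause
import Literature.Geometry.Lorentzian.KerrSliceFacts

/-!
# Line `old-light-forces-soft-burial` — skeleton for crux `CaptureSuffices`
# (stmt-FinalStateConjecture-9953, route PhaseMixingCapture; crux-plan round 1, GENERATION 2)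

Crux (FIXED, concluded BY NAME in `CaptureSuffices_of`):
`PhaseMixingCapture.CaptureSuffices := NearExtremalKappaCapture → BulkKerrCapture →
WeakCosmicCensorshipMGHD → FinalStateConjecture`.

Gen 2 (planner-cruxplan-stmt-FinalStateConjecture-9953-old-light-forces-sof-g2-0, 2026-08-16) is a
RE-AUDIT of the gen-1 skeleton (rev 2, skeleton `591c897e3115`, 5 stubs) against the gen-2 triage
panel (TRIAGE-r1-1 and TRIAGE-r1-2 at gen 2, TRIAGE-r1-3), the standing disproof rev 2c and the landed Negative
lemmas of this crux family. Outcome: the five stub STATEMENTS are kept verbatim (names, binders and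
meaning unchanged, so the registration is continuous); what changes is (α) the capture package is now
the disprover's LANDED `Theorems.BulkKerrCapture.Negative.CaptureAt` (imported, no local copy), so
`CaptureUpgrade` / `SoftShieldedSettles` speak about the very predicate the Negative files classify
and `captureAt_of_bulkKerrCapture` is three lines over `bulkKerrCapture_iff`; (β) the slice half of
the shielding predicate is DISCHARGED against the landed `KerrShieldedDataExist.Negative.SliceClause`
(`isSoftKerrShielded_of_graph`, §5: the stub-1 prover owes only the data-side clauses); (γ) the
docstrings of Stubs 1, 2, 4 carry the gen-2 technique nudges (orientation of the capture chart is an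
INTERNAL soft lemma of Stub 4, the CBG asymmetry of Stub 2 and where to attack it, the `a := 0`
special case of Stub 1) and the gen-2 triage answers.

## The line in one paragraph
Old light is heavy in the isotropic `H^s_δ` capture norm (appendix (A), `OldLightLowerBound`), so
the capture hypotheses can only be fed data that are GLOBALLY near Kerr at the moment of
invocation; the one design that survives the adversarial `(s, δ)` and DR-admissibility is SOFT
BURIAL: glue the given admissible datum, shrunk by dilation, into the core `{r ≤ M}` of a fixed
shield that is `ε`-close to the Kerr–Schild leaf data on the collar `{M < r < 4M}` and EXACT bent
Schwarzschild/slow-Kerr beyond `4M` (`IsSoftKerrShielded`); consume `BulkKerrCapture` ONCE, at one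
mass `M₀ = 1` and spins `|a| ≤ 1/2` (`captureAt_of_bulkKerrCapture`, proved), on the Kerr–Schild
LEAF `S = ι∘φ(collar) ∪ {t* = 0, r ≥ 4M}` INSIDE any MGHD of the buried datum (the leaf's far part
sits in the exact region below the bent slice, at distance `0`), via hypersurface sub-data
maximality (`HypersurfaceMGHDRealised`); read the capture conclusions back in the MGHD and
assemble the summit clauses (`SoftShieldedSettles`); undo the dilation (`ScaleCovariance`); and
close through SwallowTheDatum's landed frame `SwallowTheDatum.closes` (curve-genericity is
topology-free). `NearExtremalKappaCapture` and `WeakCosmicCensorshipMGHD` are NOT consumed.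

## Registered stubs (5) + one registered obligation
* `stub_approxKerrBurial : ApproxKerrBurial` — data side (L–XL, HARDEST durable piece): parametric
  soft burial with dilation.
* `stub_hypersurfaceMGHDRealised : HypersurfaceMGHDRealised` — (L) sub-data maximality for an
  ACAUSAL spacelike hypersurface of an MGHD, realised form (the triage panel's explicit request).
* `stub_captureUpgrade : CaptureUpgrade` — the `k`-ADVERSARIAL branch made explicit (gen-2 panel,
  TRIAGE-r1-2: "file the upgrade as a shared stub"): capture in `C⁰` ⇒ capture in `C²` at the same
  package (`CaptureAt s δ 0 … → CaptureAt s δ 2 …`); XL as typed (the regularity half of Kerr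
  stability, or interpolation + regauging + bounded late geometry, card interpolation-defangs-sharp-form),
  MOOT under the owner's announced repair `k := 2` of 10606/10696 — do not staff before that ruling.
* `stub_softShieldedSettles : SoftShieldedSettles` — (L) the load-bearing consumer of `X_bulk` in the
  cheap reading: `HypersurfaceMGHDRealised → CaptureAt s δ 2 … → softly shielded admissible data settle`.
* `stub_scaleCovariance : ScaleCovariance` — (M) dilation covariance of the settling clauses.
* hypothesis `SwallowTheDatum.MGHDExists` (item stmt-FinalStateConjecture-9937, shared support of
  the summit; closes via `Theorems.mghdExists_of_choquetBruhatGeroch` once the named fact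
  `choquetBruhat_geroch_exists_mghd_cauchy` is accepted) — taken BY NAME, not re-stubbed.
Composition: `CaptureSuffices_of : Goal.stub_approxKerrBurial → Goal.stub_hypersurfaceMGHDRealised →
Goal.stub_captureUpgrade → Goal.stub_softShieldedSettles → Goal.stub_scaleCovariance →
SwallowTheDatum.MGHDExists → PhaseMixingCapture.CaptureSuffices` (kernel-checked, no `sorry` of its
own: the adversarial `k` is lowered to `0` by monotonicity, `captureAt_zero_of_captureAt`, raised to `2`
by Stub 3, consumed by Stub 4; it even factors through `SwallowTheDatum.UniversalWitnessFamily`,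
decl 10051).

## Disproof used (`Cruxes/CaptureSuffices/Disproof.lean`, cdisprove cycle 1 rev 2c; rc 0, no `¬`/`_false_without_`)
* `captureSuffices_iff_sharp` / `bulkKerrCapture_iff_sharp` (adversarial witnesses `k = 0`, `s ≥ s₀`,
  `δ ≥ δ₀`, `C ≥ 0`): honoured STRUCTURALLY — the composition lowers the received `k` to `0`
  (`captureAt_zero_of_captureAt`, the disproof's monotonicity) and the `C⁰ → C²` content is the NAMED stub
  `CaptureUpgrade`, so nothing is hidden; the cheap reading (Stub 4 alone) is exactly the owner's announced
  repair `k := 2` (§B REPAIR of the disproof). `IsSoftKerrShielded` demands closeness in the SAME `(s, δ)`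
  the hypothesis hands over and only on a bounded collar, so adversarial `(s, δ)` cost nothing (compactly
  supported smooth corrections are finite in every `H^s_δ` of a bounded set).
* §D `dataWeightedSobolevEDist_kerr_eq_top(_of_neg_half_le)` / `kerr_not_mem_basin` (basins pin the ADM
  mass for `δ ≥ -1/2`) and the triage's C1/F3 (KS leaf data are not DR-admissible): evaded by design — the
  comparison is made on the Kerr–Schild LEAF inside the development, whose far part is EXACT Kerr of the
  SAME mass (distance `0` there), never on an admissible datum's own slab.
* `captureSuffices_iff_wcc_iff_fsc`, `not_captureSuffices_witness`: the line never consumes `W`.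
* §F `CaptureSufficesAt s δ k γ p` (advisory repaired crux): Stubs 1, 2, 4, 5 close `CaptureSufficesAt s δ 2 γ p`
  verbatim; only `captureAt_of_bulkKerrCapture` changes and Stub 3 disappears.
* Landed negatives IMPORTED / checked against: `Theorems.BulkKerrCapture.Negative.SpinGapAndMass`
  (imported: `CaptureAt`, `bulkKerrCapture_iff`; the line instantiates `a₁ = 1/2 < 1`, `M₀ = 1 > 0`,
  `|a| ≤ M₀/2`, inside both load-bearing hypotheses of `bulkCaptureFamily_false_without_spinGap/_posMass`
  and inside class (ii) of `DegenerateCentres.bulkCaptureFamily_classification`), `PointwiseVsUniform`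
  (the non-uniformity of `ε(M)` in `M` is neutralised by ONE mass + dilation; spin-uniformity on
  `|a| ≤ M₀/2` is consumed — free, it is a hypothesis of the crux — and even avoidable with `a := 0`, see
  Stub 1), `Theorems.CaptureSuffices.Negative.{AdversarialWitnesses, CounterexampleShape, KerrMassPinning,
  KerrMassPinningCritical}` (equivalences / counterexample shape / mass pinning: no stub is an instance —
  the stubs are a data-existence statement, a causality theorem, a regularity upgrade between two instances
  of the capture matrix, consequence-form bookkeeping and a scaling lemma),
  `Theorems.KerrShieldedDataExist.Negative.SliceClause` (imported: POSITIVE support — the pinned bent graph is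
  spacelike with a future unit normal at every inner radius, so clause (ii) of the shield is satisfiable).
-/

noncomputable section

set_option linter.dupNamespace false

namespace Summit.FinalStateConjecture.FinalStateConjecture.Cruxes.CaptureSuffices.OldLightForcesSoftBurial

open Set Filter Function Topology
open scoped Manifold ContDiff
open Literature.Geometry.Lorentzian
open Summit.FinalStateConjecture.FinalStateConjecture.Theses
open Summit.FinalStateConjecture.FinalStateConjecture.Theorems.KerrShieldedDataExist.Negative
  (bentHeight graph graphNormal isSpacelikeImmersion_graph isFutureUnitNormal_graphNormal coe_graph)
open Summit.FinalStateConjecture.FinalStateConjecture.Theorems.BulkKerrCapture.Negative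
  (CaptureAt bulkKerrCapture_iff)

/-! ## §1 Vocabulary of the line (definitions; nothing here is a route item) -/

/-- The **collar** `{M < r < 4M}` of the Kerr–Schild slice `{t* = 0}` (Kerr–Schild radius
`r = Kerr.radius a (0, y)`), as a subset of `E3`: the only part of the shield on which APPROXIMATE
Kerr-ness is demanded (the bent height `T_{M,a}` vanishes on `r ≤ 4M`, `bentHeight_eq_zero_of_le`, so
there the admissible bent slice IS the Kerr–Schild leaf). [folklore] -/
def collar (a M : ℝ) : Set E3 :=
  {y | M < Kerr.radius a (E4.ofTimeSpace 0 y) ∧ Kerr.radius a (E4.ofTimeSpace 0 y) < 4 * M}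

/-- **ε-SOFT KERR SHIELDING at level `(s, δ)`** of a datum `D` on `X` by Kerr `(M, a)`: an open
embedding `φ : Kerr.slice a M = {t* = 0, r > M} → X` with compact complement of its range such that
(i) on the collar `{M < r < 4M}` the pulled-back data are `ε`-close, in `H^s_δ × H^{s-1}_{δ+1}` OF THE
COLLAR, to the Kerr–Schild leaf data `Kerr.data M a M` (the two seminorms are verbatim the two summands of
`InitialDataSet.dataWeightedSobolevEDist` with `U` replaced by the collar; `hFun`/`kFun` are the
junk-extended component functions of `WeightedNorms.lean`, smooth on the open slice ⊇ collar), and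
(ii) beyond `r ≥ 4M` they ARE the data induced on the graph `ψ` of the bent height `T_{M,a}` in the
ingoing Kerr–Schild chart (the exact clause of SwallowTheDatum's shielding predicate, restricted to
`r ≥ 4M`; DR-admissible because the far slice is Boyer–Lindquist-bent). Junction radius
`r₁ = M ∈ (r₋, r₊)`; exactness is kept exactly where the adversarial far weight `(1 + ‖y‖)^{2(δ+m)}`
and DR-admissibility require it. The `ψ`-conjuncts of (ii) are dischargeable today
(`isSoftKerrShielded_of_graph`, §5). [folklore] -/
def IsSoftKerrShielded [Kerr.Facts] [Kerr.SliceFacts] (s : ℕ) (δ ε M a : ℝ) (X : Type)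
    [TopologicalSpace X] [ChartedSpace E3 X] [IsManifold (𝓡 3) ∞ X]
    (D : InitialDataSet (𝓡 3) X) : Prop :=
  ∃ (hM : 0 ≤ M) (φ : Kerr.slice a M → X) (hφ : ContMDiff 𝓘(ℝ, E3) (𝓡 3) (∞ + 1) φ)
    (hφ' : ∀ u, Function.Injective (mfderiv 𝓘(ℝ, E3) (𝓡 3) φ u))
    (ψ : Kerr.slice a M → Kerr.region a M) (ν : NormalField 𝓘(ℝ, E4) ψ),
    |a| < M ∧ IsCompact (Set.range φ)ᶜ ∧ Topology.IsOpenEmbedding φ ∧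
    -- (i) collar closeness to the Kerr–Schild leaf data, in the level `(s, δ)` of the hypothesis
    weightedSobolevSeminorm (collar a M) s δ
        ((D.comap φ hφ hφ').hFun - (Kerr.data M a M hM).hFun) +
      weightedSobolevSeminorm (collar a M) (s - 1) (δ + 1)
        ((D.comap φ hφ hφ').kFun - (Kerr.data M a M hM).kFun) < ENNReal.ofReal ε ∧
    -- (ii) exact bent Kerr beyond `4M`
    (∀ y : Kerr.slice a M, (ψ y : E4) =
      E4.ofTimeSpace (bentHeight M a (Kerr.radius a (E4.ofTimeSpace 0 (y : E3)))) (y : E3)) ∧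
    (Kerr.smoothMetric M a M).IsSpacelikeImmersion 𝓘(ℝ, E3) ψ ∧
    (Kerr.smoothMetric M a M).IsFutureUnitNormal 𝓘(ℝ, E3)
      ((Kerr.timeOrientation M a M hM).ofLE le_top) ψ ν ∧
    (∀ y : Kerr.slice a M, 4 * M ≤ Kerr.radius a (E4.ofTimeSpace 0 (y : E3)) →
      pullbackBilin (I := 𝓡 3) (I' := 𝓘(ℝ, E3)) φ D.h.inner y =
        pullbackBilin (I := 𝓘(ℝ, E4)) (I' := 𝓘(ℝ, E3)) ψ (Kerr.smoothMetric M a M).val y) ∧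
    (∀ [(Kerr.smoothMetric M a M).HasLeviCivita] (y : Kerr.slice a M),
      4 * M ≤ Kerr.radius a (E4.ofTimeSpace 0 (y : E3)) →
      (pullbackBilin (I := 𝓡 3) (I' := 𝓘(ℝ, E3)) φ D.k y).toLinearMap₁₂ =
        (Kerr.smoothMetric M a M).secondFundamentalForm 𝓘(ℝ, E3) ψ ν y)

/-! ### The capture package
`CaptureAt s δ k M hM ε C a` is, from gen 2 on, the LANDED
`Theorems.BulkKerrCapture.Negative.CaptureAt` (standing disprover of item 10696): every
vacuum-constraint solution on `Kerr.slice a M` within `H^s_δ`-distance `ε` of `Kerr.data M a M` has all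
its maximal vacuum Cauchy developments far-complete (`DataEmbedding.HasCompleteFutureNullInfinityFar`,
= the route decl's inlined far-origin sojourn clause after `range_farSliceIncl`), with a region converging
in `Cᵏ` to a sub-extremal Kerr and a `C √dist` modulus. This is the ONLY form in which the line touches
the route's hypotheses. Typed weaknesses inherited from item 10696 (the prover's burden in
`SoftShieldedSettles`, not defects of this line): `k` existential upstream (adversarial witness `k = 0`,
`bulkKerrCapture_iff_sharp`); `𝒟oc` existential; `IsLateEmbedding` carries no time-orientation clause. -/

/-- `BulkKerrCapture` hands over, for the compact spin range `|a| ≤ M/2` (instantiate `a₁ := 1/2`) and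
ANY chosen mass, one `CaptureAt` package with `(ε, C)` UNIFORM in the spin — all of the route's
hypotheses that the line consumes (spin-uniformity absorbs the small angular momentum of the glued core;
the mass is fixed once and for all, `M₀ = 1`, the growth of the shields being carried by dilation of the
data). Inside both load-bearing hypotheses of `Theorems.BulkKerrCapture.Negative.SpinGapAndMass`
(`a₁ < 1`, `0 < M`); over the disprover's `bulkKerrCapture_iff`. [folklore] -/
theorem captureAt_of_bulkKerrCapture [Kerr.Facts] [Kerr.SliceFacts]
    (hBulk : PhaseMixingCapture.BulkKerrCapture) :
    ∃ (s : ℕ) (δ : ℝ) (k : ℕ), ∀ (M : ℝ) (hM : 0 < M), ∃ ε > (0 : ℝ), ∃ C : ℝ,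
      ∀ a : ℝ, |a| ≤ M / 2 → CaptureAt s δ k M hM.le ε C a := by
  have h' := bulkKerrCapture_iff.1 hBulk
  obtain ⟨s, δ, k, h⟩ := h' (1 / 2) (by norm_num)
  refine ⟨s, δ, k, fun M hM ↦ ?_⟩
  obtain ⟨ε, hε, C, hC⟩ := h M hM
  exact ⟨ε, hε, C, fun a ha ↦ hC a (by linarith)⟩

/-- **Monotonicity in the convergence order** (the disproof's `Spacetime.ConvergesTo.of_le` leg of
`bulkKerrCapture_iff_sharp`): a `CaptureAt` package at any order `k` yields the `C⁰` package. This is how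
the composition meets the ADVERSARIAL `k`: whatever order `BulkKerrCapture` hands over is lowered to `0`
and then raised to `2` by the named stub `CaptureUpgrade`. [folklore] -/
theorem captureAt_zero_of_captureAt [Kerr.Facts] [Kerr.SliceFacts] {s : ℕ} {δ : ℝ} {k : ℕ} {M : ℝ}
    {hM : 0 ≤ M} {ε C a : ℝ} (h : CaptureAt s δ k M hM ε C a) : CaptureAt s δ 0 M hM ε C a := by
  intro D _ hvac hdist 𝒟 h𝒟
  obtain ⟨M', a', 𝒟oc, hsub, hfar, hconv, hmod⟩ := h D hvac hdist 𝒟 h𝒟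
  exact ⟨M', a', 𝒟oc, hsub, hfar, hconv.of_le (Nat.zero_le _), hmod⟩

/-- `D'` is the **`λ`-dilate** of `D`: `h' = λ² h`, `k' = λ k` (the scaling symmetry of the vacuum
constraints; Bartnik–Isenberg 2004, §2). A `Prop`, so no metric needs to be rebuilt. [folklore] -/
def IsDilateOf {X : Type} [TopologicalSpace X] [ChartedSpace E3 X] [IsManifold (𝓡 3) ∞ X]
    (lam : ℝ) (D D' : InitialDataSet (𝓡 3) X) : Prop :=
  (∀ (x : X) (v w : TangentSpace (𝓡 3) x), D'.h.inner x v w = lam ^ 2 * D.h.inner x v w) ∧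
    ∀ (x : X) (v w : TangentSpace (𝓡 3) x), D'.k x v w = lam * D.k x v w

/-- The **`∀`-MGHD clauses of the summit conclusion** at a datum `D` (complete `𝓘⁺` in the sojourn form
and a sub-extremal EXHAUSTIVE `C²` final-state decomposition of `O = exteriorOf …` in every maximal vacuum
Cauchy development) — verbatim the second conjunct of the matrix of `FinalStateConjecture` (and of
`SwallowTheDatum.UniversalWitnessFamily`). [folklore] -/
def SettlingClauses {X : Type} [TopologicalSpace X] [ChartedSpace E3 X] [IsManifold (𝓡 3) ∞ X]
    [ConnectedSpace X] (D : InitialDataSet (𝓡 3) X) : Prop :=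
  ∀ 𝒟 : VacuumCauchyDevelopment D, 𝒟.IsMaximal →
    Summit.FinalStateConjecture.HasCompleteNullInfinity 𝒟.toCauchyDevelopment ∧
      ∃ (O : Set 𝒟.carrier) (dec : FinalStateDecomposition 𝒟.toSpacetime O 2),
        (∀ i, Kerr.IsSubextremal (dec.mass i) (dec.spin i)) ∧
          O = Summit.FinalStateConjecture.exteriorOf 𝒟.toCauchyDevelopment dec.charted ∧
            Summit.FinalStateConjecture.HasExhaustiveCharts dec

/-! ## §2 The five stub statements -/

/-- **STUB 1 — APPROXIMATE (SOFT) PARAMETRIC KERR BURIAL** (data side; rank: HARDEST; size L–XL).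
For every level `(s, δ)`, tolerance `ε > 0` and ONE shield mass `M > 0`: through every admissible datum
`d` on `X` passes a jointly smooth (`IsSmoothDataFamily` = joint `ContMDiff` on `ℝ¹ × X`, nothing else),
injective, admissible one-parameter family with `F 0 = d` such that every member `F c`, `c ≠ 0`, has an
admissible DILATE (`h ↦ λ²h`, `k ↦ λk`, `λ = λ(c)`) which is ε-softly Kerr-shielded at level `(s, δ)`
with that mass and some spin `|a| ≤ M/2`.
Intended proof (softened `SwallowTheDatum.ParametricKerrBurial`, shares its d-side verbatim with item
10052): a FIXED admissible shield template on `ℝ³` — exact bent Schwarzschild (or slow Kerr) beyond `4M`,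
`ε/2`-close to the Kerr–Schild leaf on the collar, with a KID-free open pocket inside `{r < M}` (templates
exist: the exact shields certified in Cruxes/KerrShieldedDataExist/TRIAGE-r1-*, Kehle–Unger
arXiv:2304.08455 Cor. 2, Li–Mei arXiv:2005.01249 §2.2; an ε-soft template may also be produced by
Chruściel–Delay / Corvino–Schoen IFT gluing with OPEN tolerance, the remark salvaged from card
soft-burial-open-basin); SOFTNESS is what makes the pocket KID-free cheaply: a generic `ε/4`-perturbation
of the template supported in `{r < 4M}` kills all KIDs there (Beig–Chruściel–Schoen gr-qc/0403042), after
which the `λ(c)`-shrunk `d` is glued into the pocket with corrections supported in a KID-free annulus and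
the exterior `{r ≥ 4M}` untouched EXACTLY (Hintz arXiv:2210.13960 Thm 1.1–1.2 at a KID-free point;
Mao–Oh–Tao arXiv:2308.13031 obstruction-free annular gluing) — no cokernel, hence no charge bookkeeping.
(If instead the Kerr family is used to absorb the Corvino–Schoen cokernel: linear momentum must vanish —
it does, DR rates `k = o(r⁻²)` force `P = 0` for `d` and for the template —, angular momentum goes into the
comparison spin `|a| ≤ M/2` (the one place the spin-uniformity of `X_bulk` is spent), the centre into a
translation of `φ`, and the mass into the dilation `λ`; a BOOST is not available, clause (ii) being exact.)
SPECIAL CASE `a := 0` (gen 2): with an exact SCHWARZSCHILD far end the core's angular momentum is absorbed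
in the transition annulus by obstruction-free gluing (Czimek–Rodnianski arXiv:2210.09663; Kehle–Unger
arXiv:2304.08455 Cor. 2 glues to an exact Schwarzschild exterior) — then the line consumes `X_bulk` at the
single Schwarzschild centre only and its unprinted spin-uniformity (`PointwiseVsUniform.lean`) is idle too.
Then `λ = exp(−1/c²)`, the member being the `λ⁻¹`-upscaled glued datum transported to the fixed `X` (so
`F c = d` on compacts exhausting `X` ⇒ joint smoothness at `c = 0` by eventual constancy; injectivity by
pairwise distinct scales). Corrections may leak anywhere inside `{r < 4M}` (only `ε/2` of collar room is
needed) — the pain points of 10052 (exactness inside `r₊`, corrections confined to an exact pocket of an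
exactly-Kerr-shielded background) are deleted. The `ψ`-half of clause (ii) is free
(`isSoftKerrShielded_of_graph`, §5: take `ψ := graph M a M`, `ν := graphNormal M a M` of the landed
`KerrShieldedDataExist.Negative.SliceClause`); the far end is DR-admissible because the bent slice is
asymptotically Boyer–Lindquist (gen-2 triage X4 "DR tails vs δ-window" concerns RAW tails fed to an adapter
and does not arise: members are exact Kerr beyond `4M/λ`).
Why it might fail: joint `C^∞` in `c` on the FIXED `X` together with admissibility (exact constraints,
completeness, DR rates) for ALL `c` and injectivity may clash; Hintz's gluing is polyhomogeneous in the
small parameter, not smooth (reparametrise `λ = exp(−1/c²)`); the pocket must be KID-free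
(Beig–Chruściel–Schoen gr-qc/0403042). Leans on: `InitialDataSet.IsSmoothDataFamily`,
`admissibleVacuumData`, `IsSoftKerrShielded`, `IsDilateOf`; prints above. [folklore] -/
def ApproxKerrBurial : Prop :=
  ∀ [Kerr.Facts] [Kerr.SliceFacts] (s : ℕ) (δ ε : ℝ), 0 < ε → ∀ (M : ℝ), 0 < M →
    ∀ (X : Type) [TopologicalSpace X] [ChartedSpace E3 X] [IsManifold (𝓡 3) ∞ X] [T2Space X]
      [SecondCountableTopology X] [ConnectedSpace X],
      ∀ d ∈ admissibleVacuumData X,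
        ∃ F : EuclideanSpace ℝ (Fin 1) → InitialDataSet (𝓡 3) X,
          InitialDataSet.IsSmoothDataFamily 1 F ∧ F 0 = d ∧ Function.Injective F ∧
            (∀ c, F c ∈ admissibleVacuumData X) ∧
              ∀ c ≠ 0, ∃ (D' : InitialDataSet (𝓡 3) X) (lam a : ℝ), 0 < lam ∧ |a| ≤ M / 2 ∧
                D' ∈ admissibleVacuumData X ∧ IsDilateOf lam (F c) D' ∧
                  IsSoftKerrShielded s δ ε M a X D'

/-- **STUB 2 — HYPERSURFACE SUB-DATA MAXIMALITY, realised form** (size L; the triage panel's explicit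
request, TRIAGE-r1-1/2/3: "SoftShieldedSettles needs SubdataDevelopmentsEmbed for the HYPERSURFACE
`S ⊂ 𝓜`, not an open subset of `X` — file that generalisation explicitly").
Let `𝓜` be a MAXIMAL vacuum Cauchy development of data `D` on `X`, and let `j : N → 𝓜` (`N` a connected
`3`-manifold) be a smooth embedding with future unit normal `ν` which INDUCES the data `D'` on `N`
(`j^* g = h'`, `K_ν(j) = k'` — literally the fields `induced_h` / `induced_k` of `DataEmbedding`, with
`𝓜`'s own spacetime) and whose image is ACAUSAL in `𝓜` (no two distinct points causally related).
Then the data `D'` have a maximal vacuum Cauchy development `𝒟'` REALISED INSIDE `𝓜`: a smooth,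
time-orientation preserving, isometric open embedding `χ : 𝒟' → 𝓜` with `χ ∘ ι' = j`.
Intended proof (Choquet-Bruhat–Geroch 1969 Thm 3 / Sbierski arXiv:1309.7591 §3, RELATIVE TO A
HYPERSURFACE; the three-piece frame of the sibling item is LANDED as
`Theorems.SubdataDevelopmentsEmbed.subdataDevelopmentsEmbed_of_skeleton (hloc) (hdod) (hmax)` and its
pieces `…SubdataDevelopmentsEmbed{DoD,MCGHD,Hmax,Realise,Rigidity}.lean` are stated relative to `ι ∘ Φ`;
re-run them with `ι ∘ Φ` replaced by `j`): (a) `V := int D_𝓜(j N)` with `𝓜`'s structures restricted is a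
vacuum Cauchy development of `D'` (`j(N) ⊂ int D(j N)` for an acausal spacelike hypersurface; `int D`
globally hyperbolic, Hawking–Ellis Prop. 6.6.3; vacuum and induced data inherited) — realise it as the
`𝒟'` of the statement, `χ` the inclusion; (b) MAXIMALITY of `V` (`IsMaximal` is the universal property:
every vacuum Cauchy development `𝒟''` of `D'` embeds into `V`): maximal common sub-development `U` of
`𝒟''` and `V` over `j` (relative Zorn, `exists_maximal_relCGHD`), and `U = 𝒟''` by the
no-corresponding-boundary-points + Hausdorff-gluing argument (`top_of_noCorrespondingBoundary_of_gluing`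
pattern) — NOTE THE ASYMMETRY (gen 2): `𝓜` is not a development of `D'`, and no point of `∂_𝓜 V` is
locally developable from inside `V` (`int D_𝓜(T) ⊆ V` for every `T ⊆ V`), so corresponding boundary points
must be attacked from the `𝒟''` side, where `j''(N)` IS Cauchy: a first boundary point `e ∈ ∂_{𝒟''} U`
has `I⁻(e) ∩ I⁺(j'' N) ⊆ U`; either the corresponding curves converge in `𝓜` to some `p` — then `p ∉ V`
and local uniqueness from a spacelike cap `T ⊆ U` below `e` (with `e ∈ int D_{𝒟''}(T)`) glues a
neighbourhood of `e` onto `𝓜` ACROSS `p`, producing a vacuum development of `(X, D)` in which `ι(X)` is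
still Cauchy (every new point lies in `int D(T)`, `T ⊆ V ⊆ 𝓜`) and which is not embedded in `𝓜` — against
maximality of `𝓜`; or they do not converge in `𝓜` — then the same gluing extends `𝓜` outright; Cauchy-ness
of `ι(X)` in the glued spacetime uses (α) acausality of `j(N)` in `𝓜`, (β) `j(N)` Cauchy in `𝒟''`,
(γ) causal convexity of `V`; (c) the image of any embedding over `j` lies in `D_𝓜(j N)` (it is globally
hyperbolic with Cauchy hypersurface `j(N)`; an inextendible-in-the-image causal curve meets `j(N)` before
leaving), hence in `V`; rigidity over a hypersurface (`eq_of_comp_embed_eq_rel` pattern) identifies it with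
a sub-development of `V`. The range identity `range χ = int D_𝓜(j N)` is part of the proof and may be exposed
as a `--supports` lemma (the Stub-4 prover re-derives what he needs from `IsMaximal` + rigidity); it is NOT
stated here because the prelude's set-level `LorentzianMetric.cauchyDevelopment` is typed over the defective
`IsPastInextendible` (Causality.lean, § "Endpoints, endless curves": faithful notions are `IsPastEndless` etc.).
MGHD EXISTENCE for the (incomplete, non-admissible) leaf data is NOT assumed: (a)+(b) construct it.
Why it might fail: as for item 10053 — local geometric uniqueness (Hawking–Ellis §7.5) is not yet in the
tree; a typing defect of `CauchyDevelopment`/`IsCauchyHypersurface` could falsify the letter; acausality (not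
mere achronality) is what the Cauchy-verification of the glued spacetime uses — the statement is FALSE for
non-maximal `𝓜` (thin slab in Minkowski, `N` a disc) and for non-achronal spacelike `j` (helicoidal strips),
both excluded by the hypotheses; for FLAT data the statement is elementary (developing map: a boundary point
of `V` in a larger flat development would be fixed by `dev`, contradiction), which is the sanity check run at
gen 2. Leans on: `VacuumCauchyDevelopment`, `IsMaximal` (universal-property form, CauchyDevelopment.lean),
`DataEmbedding` field shapes, `IsIsometricImmersion`, `PreservesTimeOrientation`, `causalFuture`; prints
ChoquetBruhatGeroch1969CMP Thm 3, arXiv:1309.7591 Thms 2.7–2.8/12/17, HawkingEllis1973CUP §6.5–6.6, §7.5–7.6,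
Ringstrom2009 Ch. 16/23. [folklore] -/
def HypersurfaceMGHDRealised : Prop :=
  ∀ (X : Type) [TopologicalSpace X] [ChartedSpace E3 X] [IsManifold (𝓡 3) ∞ X] [T2Space X]
    [SecondCountableTopology X] [ConnectedSpace X] (D : InitialDataSet (𝓡 3) X)
    (𝓜 : VacuumCauchyDevelopment D), 𝓜.IsMaximal →
    ∀ (N : Type) [TopologicalSpace N] [ChartedSpace E3 N] [IsManifold (𝓡 3) ∞ N] [ConnectedSpace N]
      (D' : InitialDataSet (𝓡 3) N) (j : N → 𝓜.carrier) (ν : NormalField (𝓡 4) j),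
      Manifold.IsSmoothEmbedding (𝓡 3) (𝓡 4) ∞ j →
      𝓜.metric.IsFutureUnitNormal (𝓡 3) 𝓜.timeOrientation j ν →
      (∀ y : N, pullbackBilin (I := 𝓡 4) (I' := 𝓡 3) j 𝓜.metric.val y = D'.h.inner y) →
      (∀ [𝓜.metric.toPseudoRiemannianMetric.HasLeviCivita] (y : N),
        𝓜.metric.toPseudoRiemannianMetric.secondFundamentalForm (𝓡 3) j ν y = D'.kBilin y) →
      (∀ p ∈ Set.range j, ∀ q ∈ Set.range j,
        q ∈ 𝓜.metric.causalFuture 𝓜.timeOrientation {p} → q = p) →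
      ∃ 𝒟' : VacuumCauchyDevelopment D', 𝒟'.IsMaximal ∧
        ∃ χ : 𝒟'.carrier → 𝓜.carrier, ContMDiff (𝓡 4) (𝓡 4) ∞ χ ∧ Topology.IsOpenEmbedding χ ∧
          𝒟'.metric.IsIsometricImmersion 𝓜.metric.toPseudoRiemannianMetric χ ∧
          𝒟'.timeOrientation.PreservesTimeOrientation χ 𝓜.timeOrientation ∧ χ ∘ 𝒟'.embed = j

/-- **STUB 3 — CAPTURE UPGRADE `C⁰ ⇒ C²`** (the `k`-adversarial branch of the line as a NAMED statement;
size XL as typed, MOOT under the owner's announced repair `k := 2` of items 10606/10696 — the lead should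
not staff it before that ruling). At a fixed package `(s, δ, M, ε, C, a)`: if every MGHD of every
vacuum-constraint solution on `Kerr.slice a M` within `ε` of `Kerr.data M a M` is far-complete and
converges in `C⁰` to a sub-extremal Kerr with modulus `C √dist` (`CaptureAt s δ 0 …`), then the same holds
in `C²` (`CaptureAt s δ 2 …`) — the far-completeness, sub-extremality and modulus clauses are carried
over unchanged, only `ConvergesToKerr 𝒟oc M' a' 0` must become `… 2` (possibly in another chart and
another region `𝒟oc`, both existential). Stated over the LANDED `BulkKerrCapture.Negative.CaptureAt`, so it
is literally an implication between two members of the disprover's classified family.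
Why it exists: the standing disproof (`bulkKerrCapture_iff_sharp`, `captureSuffices_iff_sharp`) shows
the prover of the crux receives `k = 0`; the gen-1 skeleton hid the resulting `C⁰ → C²` upgrade inside
`SoftShieldedSettles`; the gen-2 triage panel (TRIAGE-r1-2, verdict on interpolation-defangs-sharp-form)
asks for it to be FILED AS A SHARED STUB of the time-zero and late-time lines. Intended proofs: (α) the
quantitative part of Kerr stability (decay of curvature to second order in the bulk basin — in print for
`|a| ≪ M`, Klainerman–Szeftel arXiv:2104.11857 / GKS arXiv:2205.14808, whose conclusions ARE `C²`); or
(β) the interpolation card: Landau–Kolmogorov/Gagliardo–Nirenberg on unit corner cubes of the late region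
(`Kerr.exists_cone_subset_slice`) turns `C⁰` decay + a UNIFORM-in-time `C⁴` bound of the deviation in a
regauged chart into `C²` decay (`InterpolationUpgrade`, `Regauging` of
Cruxes/CaptureSuffices/SketchIdeator1g2.lean) — the bound being the honest heavy input ("bounded late
geometry without decay"; the bet: no Burnett cascade along sub-extremal limits). Gen-2 triage F2 (the `k = 0`
witness chart may have unbounded `C¹` deviation even on exact Kerr) is why (β) needs the REGAUGING stub and
why no chart-independent boundedness hypothesis can replace it.
Why it might fail: only if some package has `C⁰`-capture TRUE and `C²`-capture FALSE, i.e. some development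
of ε-close leaf data converges to Kerr in `C⁰` in some chart while in NO chart its curvature converges — no
mechanism known for smooth vacuum developments of near-Kerr data, but nothing printed excludes it at an
adversarial `(s, δ, ε)`; as a material implication the statement is true wherever `C²`-capture holds at the
package and (vacuously) wherever `C⁰`-capture fails. Plausibly TRUE; XL to PROVE as typed. Leans on:
`CaptureAt`, `Spacetime.ConvergesToKerr/ConvergesTo`, `deviationCk`; prints arXiv:2104.11857,
arXiv:2205.14808, arXiv:2104.08222 Ch. 8, Anderson arXiv:gr-qc/0208079 Def. 1.1. [folklore] -/
def CaptureUpgrade : Prop :=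
  ∀ [Kerr.Facts] [Kerr.SliceFacts] (s : ℕ) (δ : ℝ) (M : ℝ) (hM : 0 < M) (ε C a : ℝ),
    CaptureAt s δ 0 M hM.le ε C a → CaptureAt s δ 2 M hM.le ε C a

/-- **STUB 4 — SOFT SHIELDED SETTLES** (the `X_bulk`-fed analogue of `SwallowTheDatum.KerrShieldedSettles`;
the load-bearing consumer of the route's hypothesis in the CHEAP READING `k = 2`; size L). GIVEN
hypersurface sub-data maximality (Stub 2), one `C²` capture package at `(s, δ, M, ε, C, a)` implies the
`∀`-MGHD clauses of the summit conclusion for every ADMISSIBLE datum that is ε-softly Kerr-shielded at the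
same level.
Intended proof, in the order the lead will meet the pieces (each a foreseeable `--supports` lemma or
child): let `𝓜` be an MGHD of `D`, `ι = 𝓜.embed`, `(φ, ψ, ν)` the shield.
(a) EXACT REGION: the explicit Kerr region `W` = domain of dependence, in `Kerr.region a M`, of the bent
    far slice `{t* = T(r), r > 4M}` is a vacuum Cauchy development of `D.comap (φ|{r>4M})` (Kerr is vacuum;
    `W` globally hyperbolic) and embeds into `𝓜` over `ι ∘ φ` (Stub 2 with `j = ι ∘ φ|{r>4M}` realises the
    MGHD of these sub-data inside `𝓜`; `W` embeds into that MGHD by maximality — or use item 10053) —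
    shared verbatim with KerrShieldedSettles' foreseen child `ExteriorIsExactKerr`; the leaf's
    far part `{t* = 0, r > 4M}` lies in `W` (ingoing ray from `(0, R)` meets the bent slice at `r' > 4M`,
    outgoing rays out-climb `T ~ 2M log r`; TRIAGE-r1-2/3).
(b) THE LEAF: `j : Kerr.slice a M → 𝓜`, `j y = ι (φ y)` for `r(y) ≤ 4M`, `j y = χ_W (0, y)` for
    `r(y) > 4M` — smooth across `r = 4M` because `T` is flat there (`Real.smoothTransition`); spacelike,
    ACAUSAL in `𝓜` (collar ⊂ ι X acausal; far part inside `W` where `t*` is a time function; mixed pairs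
    excluded because a causal curve from the leaf's far part into `J⁺(ι X)` never returns to
    `I⁻(ι X)`); induced data `D_S` = `D.comap φ` on the collar and `= Kerr.data M a M` beyond `4M`, hence
    `dataWeightedSobolevEDist s δ D_S (Kerr.data M a M) < ε` (the two summands of the distance restricted
    to the collar are clause (i) of `IsSoftKerrShielded`; the differences vanish identically on the open set
    `{r > 4M}` and the sphere `{r = 4M}` is null — an M-sized `--supports` lemma
    "distance localises to the collar"); `D_S` solves the vacuum constraints (Gauss–Codazzi from
    `Ric(g) = 0` — NOT yet in the tree, an M-sized supports lemma — or piecewise: comap-invariance on the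
    collar + `Kerr.data_isVacuumConstraintSolution`).
(c) CAPTURE: Stub 2 gives the MGHD `𝒟_S` of `D_S` realised in `𝓜` by `χ`; `CaptureAt` applied to
    `(D_S, 𝒟_S)` gives `(M', a', 𝒟oc)`, the far-origin sojourn clause and `ConvergesToKerr 𝒟oc M' a' 2`,
    transported into `𝓜` along the time-oriented isometric embedding `χ`.
(d) COMPLETE `𝓘⁺` OF `𝓜` (sojourn form from `ι X`): normalised rays from far points `p` of the bent slice
    are, up to an affine factor `κ = 1 + O(M/R_p)` and a shift, continuations of normalised rays from far
    LEAF points `q` (the segment `q → p` is an exact Kerr null geodesic below the bent slice and never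
    enters `J⁺(j B₀)` for large `R_p`); `B₀^X := φ(collar ∩ B₀) ∪ ι⁻¹(J⁺(j B₀) ∩ ι X)` is compact (global
    hyperbolicity); `X ∖ φ{‖y‖ > R}` is compact because `X` has one end; so the clause transfers.
(e) DECOMPOSITION (`N = 1`; this is where `C²` is needed): `O := exteriorOf 𝓜 (charted)`; hole chart = the
    transported late chart re-cut to growing near zones `{r ≤ R(τ)}` (only `truncDeviationCk → 0` is asked of
    it, `FinalStateDecomposition.tendsto_truncDeviationCk`) and τ-BENT so that its late slabs lie in
    `J⁺(ι X)` (the un-bent Kerr–Schild slabs dip below the bent slice at `r ≳ e^{τ/2M}`), flat chart in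
    Boyer–Lindquist-type time from the exact region `W` continued inward by the transported chart (full-slab
    `C²` convergence of `ConvergesToKerr` is unbounded in `r`, which is what the radiation zone between the
    excision tube `ρ(τ) = o(τ)` and `W` needs), `HasExhaustiveCharts` by horizon-normalisation (the event
    horizon of the settling hole is the normally hyperbolic continuation of Kerr's, `κ(M₀) = 1/4M₀ > 0` — no
    extremality anywhere) and the causal bookkeeping of KerrShieldedSettles; `O ∩ J⁺(ι core) = ∅` because
    every chart point lies in `D⁺_𝓜(j S)` (the core is trapped, hence behind the event horizon given (d)).
TYPED SNAGS (disclosed; findings of the standing disproof / the triage about item 10696, not about this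
line) and their status at gen 2: (1) the `k`-adversarial content is NOT here — it is the separate Stub 3
`CaptureUpgrade`. (2) ORIENTATION: `IsLateEmbedding` has no time-orientation clause and `𝒟oc` is
existential (adversarial `𝒟oc := Ψ '' lateRegion` makes `diff_subset_causalPast` vacuous), so a priori the
chart of (c) could be past-directed (TRIAGE-r1-2's time-reversed chart on exact Kerr). FOR THE LEAF
DEVELOPMENT THIS IS AN INTERNAL SOFT LEMMA, not an upstream blocker: `𝒟_S = int D_𝓜(j S)` has a SHALLOW past
near the hole — the past Cauchy horizon of the leaf's inner edge `{t* = 0, r = M}` is `{t* = M − r}` along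
the `v = const` family, so `D⁻(j S) ∩ {r ≤ 3M}` has `t*`-depth `≤ 2M` — while `deviationCk Ψ 0 τ → 0` forces
every late slab `Ψ(timeSlab τ)`, `τ ≫ 1`, to contain a near-horizon piece of `g`-volume `≈` its Kerr value
(curvature `≍ M'⁻²` must be matched, so these pieces sit in the strong-field zone of the ONE hole), and the
slabs of an open embedding are pairwise disjoint: infinitely many disjoint pieces of volume `≥ c > 0` fit
neither in the compact `J⁻(fixed slab) ∩ J⁺(j S) ∩ {strong field}` nor in the shallow past — hence the slabs
march to the future and the chart is future-directed in the sense (e) needs (`Ψ(timeSlab τ) ⊆ I⁺(ι X)` for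
`τ ≥ τ₁`). (3) `distance localises to the collar` and Gauss–Codazzi are M-sized supports lemmas, see (b).
As a PROPOSITION the stub is plausibly true (its consequent holds whenever genuine `C²`-capture holds at the
package handed over).
Why it might fail: a clause of the typed conclusion reading the hole interior (none known: KerrShieldedSettles'
disproof file found none; `exteriorOf`/`HasExhaustiveCharts` read `J⁺(ιX) ∩ I⁻(charts)`); a package where
`CaptureAt … 2` holds only through junk witnesses while genuine settling of ε-collar perturbations fails (no
mechanism known); Gauss–Codazzi / exact-region plumbing larger than budgeted. Leans on: Stub 2, `CaptureAt`,
`IsSoftKerrShielded`, `SettlingClauses`, `Summit.FinalStateConjecture.{HasCompleteNullInfinity, exteriorOf,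
HasExhaustiveCharts}`, `Spacetime.ConvergesToKerr`, `FinalStateDecomposition` (fields `tendsto_truncDeviationCk`,
`setOf_lt_excision_subset_flatDomain`, `tendsto_deviationCk_flat`, `diff_subset_causalPast`),
`Kerr.smoothMetric/timeOrientation`, `KerrShieldedDataExist.Negative.bentHeight(_eq_zero_of_le)`; prints
DafermosLuk2017 Conj. 1, arXiv:2104.08222 Ch. 8, KlainermanSzeftel2023 §3, arXiv:0811.0354 App. B,
ONeill1983 Ch. 14. [folklore] -/
def SoftShieldedSettles : Prop :=
  HypersurfaceMGHDRealised →
    ∀ [Kerr.Facts] [Kerr.SliceFacts] (s : ℕ) (δ : ℝ) (M : ℝ) (hM : 0 < M) (ε C a : ℝ),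
      CaptureAt s δ 2 M hM.le ε C a →
        ∀ (X : Type) [TopologicalSpace X] [ChartedSpace E3 X] [IsManifold (𝓡 3) ∞ X] [T2Space X]
          [SecondCountableTopology X] [ConnectedSpace X],
          ∀ D ∈ admissibleVacuumData X, IsSoftKerrShielded s δ ε M a X D → SettlingClauses D

/-- **STUB 5 — SCALE COVARIANCE of the settling clauses** (size M; it is what lets the line consume
`BulkKerrCapture` at ONE mass although the shields of the witness family grow: `X_bulk`'s `ε(M)` has no
uniformity or continuity in `M`, `Theorems.BulkKerrCapture.Negative.PointwiseVsUniform`; the gen-2 triage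
asks to keep this device visible because the late-time line needs it too).
If `D'` is the `λ`-dilate of `D` (`λ > 0`) and `D'` settles, so does `D`. Intended proof: an MGHD `𝒟` of
`D` with metric `g` yields the MGHD `𝒟^λ := (same carrier, λ² g, same τ, ι, ν/λ)` of `D'` (Levi-Civita and
Ricci are invariant under constant rescaling; `K_{ν/λ}(λ²g) = λ K_ν(g)`; Cauchy property and maximality
transfer by rescaling the competitors); `SettlingClauses D'` at `𝒟^λ` gives: sojourn completeness —
normalised rays reparametrise by `s ↦ s/λ` (`g(γ', ν) = −1`), `BddAbove` is invariant and sojourn times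
scale by `λ`, so `σ` for `𝒟` is `σλ` for `𝒟^λ`; decomposition — compose each chart with the dilation
`x ↦ λx` of `E4` and use `(δ_μ)^* g_{μM, μa} = μ² g_{M, a}` (Kerr–Schild `H` is scale-invariant), masses
`Mᵢ/λ`, spins `aᵢ/λ` (sub-extremality preserved), motions `(Λᵢ, cᵢ/λ)`, excision and truncation radii
divided by `λ`, chart times reparametrised; `exteriorOf` and the causal covering clauses are conformally
invariant; `C²` deviations pick up fixed powers of `λ` and still tend to `0`.
Why it might fail: only by a typing accident (e.g. if some clause of `FinalStateDecomposition` were not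
homogeneous — checked: `tendsto_excision_div`, `setOf_lt_excision_subset_flatDomain`,
`exists_pairwise_disjoint` are all dilation-covariant; re-checked at gen 2 against KerrConvergence.lean
ll. 727–790). Leans on: `IsDilateOf`, `SettlingClauses`, `FinalStateDecomposition`, `Kerr.smoothMetric`,
`boostedKerrBackground`, `sojournTime`, `IsNormalisedNullRayFrom`; print BartnikIsenberg2004 §2
(constraint scaling). [folklore] -/
def ScaleCovariance : Prop :=
  ∀ (X : Type) [TopologicalSpace X] [ChartedSpace E3 X] [IsManifold (𝓡 3) ∞ X] [T2Space X]
    [SecondCountableTopology X] [ConnectedSpace X] (D D' : InitialDataSet (𝓡 3) X) (lam : ℝ),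
    0 < lam → IsDilateOf lam D D' → SettlingClauses D' → SettlingClauses D

/-! ### Statements of the registered stubs, under the stub names
The skeleton audit reads the hypotheses of `CaptureSuffices_of` BY NAME: each head must be a declared
stub or a registered obligation. -/
namespace Goal

/-- Statement of `stub_approxKerrBurial`. -/
abbrev stub_approxKerrBurial : Prop := ApproxKerrBurial
/-- Statement of `stub_hypersurfaceMGHDRealised`. -/
abbrev stub_hypersurfaceMGHDRealised : Prop := HypersurfaceMGHDRealised
/-- Statement of `stub_captureUpgrade`. -/
abbrev stub_captureUpgrade : Prop := CaptureUpgrade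
/-- Statement of `stub_softShieldedSettles`. -/
abbrev stub_softShieldedSettles : Prop := SoftShieldedSettles
/-- Statement of `stub_scaleCovariance`. -/
abbrev stub_scaleCovariance : Prop := ScaleCovariance

end Goal

/-! ## §3 Registered stubs (the only `sorry`s of the file) -/

/-- **Stub 1** (L–XL, hardest): soft parametric Kerr burial with dilation — see `ApproxKerrBurial`.
[cite: Hintz2022, Thm 1.1–1.2] -/
theorem stub_approxKerrBurial : ApproxKerrBurial := by
  sorry

/-- **Stub 2** (L): hypersurface sub-data maximality, realised form — see `HypersurfaceMGHDRealised`.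
[cite: ChoquetBruhatGeroch1969CMP, Thm 3] -/
theorem stub_hypersurfaceMGHDRealised : HypersurfaceMGHDRealised := by
  sorry

/-- **Stub 3** (XL as typed; moot under the owner's `k := 2`): `C⁰` capture ⇒ `C²` capture at the same
package — see `CaptureUpgrade`. [cite: KlainermanSzeftel2023, Thm 1.1] -/
theorem stub_captureUpgrade : CaptureUpgrade := by
  sorry

/-- **Stub 4** (L): softly shielded admissible data settle, given Stub 2 and one `C²` capture package —
see `SoftShieldedSettles`. [cite: DafermosLuk2017, Conjecture 1] -/
theorem stub_softShieldedSettles : SoftShieldedSettles := by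
  sorry

/-- **Stub 5** (M): dilation covariance of the settling clauses — see `ScaleCovariance`.
[cite: BartnikIsenberg2004, §2] -/
theorem stub_scaleCovariance : ScaleCovariance := by
  sorry

/-! ## §4 The composition (kernel-checked; no `sorry` of its own) -/

/-- **SwallowTheDatum's target from the five stubs and MGHD existence.** Using from the route's
hypotheses ONLY `BulkKerrCapture`, at `a₁ = 1/2`, ONE mass `M₀ = 1` and spins `|a| ≤ 1/2`: take the
`CaptureAt` package at the adversarial order `k` (`captureAt_of_bulkKerrCapture`), lower it to `C⁰`
(`captureAt_zero_of_captureAt`) and raise it to `C²` (Stub 3); through the admissible `d` take the soft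
burial family (Stub 1); the `∃`-MGHD conjunct of each member is `MGHDExists`; its `∀`-MGHD conjunct is
the settling of the admissible dilate `D'` (Stub 4 fed with Stub 2 and the `C²` package) pulled back
along the dilation (Stub 5). `Kerr.Facts` / `Kerr.SliceFacts` are theorems of the tree
(`Kerr.isConnected_region_holds`, `Kerr.contMDiff_bilin_holds`, `Kerr.contMDiff_timeVector_holds`;
`Kerr.sliceFacts_holds`). [folklore] -/
theorem universalWitnessFamily_of
    (hB : Goal.stub_approxKerrBurial) (hH : Goal.stub_hypersurfaceMGHDRealised)
    (hU : Goal.stub_captureUpgrade) (hS : Goal.stub_softShieldedSettles)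
    (hCov : Goal.stub_scaleCovariance) (hE : SwallowTheDatum.MGHDExists)
    (hBulk : PhaseMixingCapture.BulkKerrCapture) :
    SwallowTheDatum.UniversalWitnessFamily := by
  haveI : Kerr.Facts :=
    ⟨Kerr.isConnected_region_holds, Kerr.contMDiff_bilin_holds, Kerr.contMDiff_timeVector_holds⟩
  haveI : Kerr.SliceFacts := Kerr.sliceFacts_holds
  obtain ⟨s, δ, k, hcap⟩ := captureAt_of_bulkKerrCapture hBulk
  obtain ⟨ε, hε, C, hC⟩ := hcap 1 one_pos
  have hC2 : ∀ a : ℝ, |a| ≤ 1 / 2 → CaptureAt s δ 2 1 one_pos.le ε C a := fun a ha ↦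
    @hU ‹Kerr.Facts› ‹Kerr.SliceFacts› s δ 1 one_pos ε C a (captureAt_zero_of_captureAt (hC a ha))
  intro X i₁ i₂ i₃ i₄ i₅ i₆ d hd
  obtain ⟨F, hF, h0, hinj, hadm, hshield⟩ :=
    @hB ‹Kerr.Facts› ‹Kerr.SliceFacts› s δ ε hε 1 one_pos X i₁ i₂ i₃ i₄ i₅ i₆ d hd
  refine ⟨F, hF, h0, hinj, hadm, fun c hc ↦ ⟨@hE X i₁ i₂ i₃ i₄ i₅ i₆ (F c) (hadm c), ?_⟩⟩
  obtain ⟨D', lam, a, hlam, ha, hadm', hdil, hsoft⟩ := hshield c hc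
  exact hCov X (F c) D' lam hlam hdil
    (@hS hH ‹Kerr.Facts› ‹Kerr.SliceFacts› s δ 1 one_pos ε C a (hC2 a ha) X i₁ i₂ i₃ i₄ i₅ i₆ D'
      hadm' hsoft)

/-- **THE CRUX BY NAME.** `CaptureSuffices` from the five registered stubs and the registered
obligation `SwallowTheDatum.MGHDExists` (item stmt-FinalStateConjecture-9937): introduce the three
hypotheses of the crux, discard `NearExtremalKappaCapture` and `WeakCosmicCensorshipMGHD`, and close
through SwallowTheDatum's landed deciding theorem `SwallowTheDatum.closes` applied to
`universalWitnessFamily_of`. Final assembly once the stubs land: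
`CaptureSuffices_of stub_approxKerrBurial stub_hypersurfaceMGHDRealised stub_captureUpgrade
stub_softShieldedSettles stub_scaleCovariance h9937`; under the owner's repair `k := 2` the third
argument is replaced by the trivial upgrade and Stub 3 is moot. [folklore] -/
theorem CaptureSuffices_of :
    Goal.stub_approxKerrBurial → Goal.stub_hypersurfaceMGHDRealised → Goal.stub_captureUpgrade →
      Goal.stub_softShieldedSettles → Goal.stub_scaleCovariance → SwallowTheDatum.MGHDExists →
        Summit.FinalStateConjecture.FinalStateConjecture.Theses.PhaseMixingCapture.CaptureSuffices := by
  intro hB hH hU hS hCov hE _hNear hBulk _hWCC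
  exact SwallowTheDatum.closes (universalWitnessFamily_of hB hH hU hS hCov hE hBulk)

/-! ## §5 Checked reductions against landed lemmas (no `sorry`; gen 2) -/

/-- **The `ψ`-half of the shielding predicate is free.** To softly shield a datum it suffices to produce
the embedding `φ` with the collar closeness (i) and the two DATA identities of (ii) against the PINNED
bent graph `graph M a M` and its normal `graphNormal M a M` of the landed
`Theorems.KerrShieldedDataExist.Negative.{BentSliceConormal, SliceClause}`: the graph clause is `coe_graph`,
spacelikeness is `isSpacelikeImmersion_graph`, the future unit normal is `isFutureUnitNormal_graphNormal`
(every sub-extremal `(M, a)`, every inner radius — here `r₁ = M`). What the stub-1 prover owes is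
therefore exactly the data side. [cite: arXiv08110354, §5.1] -/
theorem isSoftKerrShielded_of_graph [Kerr.Facts] [Kerr.SliceFacts] {s : ℕ} {δ ε M a : ℝ} {X : Type}
    [TopologicalSpace X] [ChartedSpace E3 X] [IsManifold (𝓡 3) ∞ X] {D : InitialDataSet (𝓡 3) X}
    (hM : 0 < M) (ha : |a| < M) (φ : Kerr.slice a M → X) (hφ : ContMDiff 𝓘(ℝ, E3) (𝓡 3) (∞ + 1) φ)
    (hφ' : ∀ u, Function.Injective (mfderiv 𝓘(ℝ, E3) (𝓡 3) φ u))
    (hcpt : IsCompact (Set.range φ)ᶜ) (hemb : Topology.IsOpenEmbedding φ)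
    (hcollar : weightedSobolevSeminorm (collar a M) s δ
        ((D.comap φ hφ hφ').hFun - (Kerr.data M a M hM.le).hFun) +
      weightedSobolevSeminorm (collar a M) (s - 1) (δ + 1)
        ((D.comap φ hφ hφ').kFun - (Kerr.data M a M hM.le).kFun) < ENNReal.ofReal ε)
    (hh : ∀ y : Kerr.slice a M, 4 * M ≤ Kerr.radius a (E4.ofTimeSpace 0 (y : E3)) →
      pullbackBilin (I := 𝓡 3) (I' := 𝓘(ℝ, E3)) φ D.h.inner y =
        pullbackBilin (I := 𝓘(ℝ, E4)) (I' := 𝓘(ℝ, E3)) (graph M a M) (Kerr.smoothMetric M a M).val y)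
    (hk : ∀ [(Kerr.smoothMetric M a M).HasLeviCivita] (y : Kerr.slice a M),
      4 * M ≤ Kerr.radius a (E4.ofTimeSpace 0 (y : E3)) →
      (pullbackBilin (I := 𝓡 3) (I' := 𝓘(ℝ, E3)) φ D.k y).toLinearMap₁₂ =
        (Kerr.smoothMetric M a M).secondFundamentalForm 𝓘(ℝ, E3) (graph M a M) (graphNormal M a M) y) :
    IsSoftKerrShielded s δ ε M a X D :=
  ⟨hM.le, φ, hφ, hφ', graph M a M, graphNormal M a M, ha, hcpt, hemb, hcollar, fun y ↦ coe_graph y,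
    isSpacelikeImmersion_graph ha M, isFutureUnitNormal_graphNormal ha M hM.le, hh, fun y hy ↦ hk y hy⟩

/-- **What the line consumes, isolated** (the audit's "X_near, W idle; X_bulk once"): the target of route
SwallowTheDatum already follows from the five stubs, `MGHDExists` and ONE spin-uniform `C⁰` capture package
at the Schwarzschild-centred range `(M₀, |a| ≤ M₀/2) = (1, ≤ 1/2)` — no `BulkKerrCapture`, no `X_near`, no `W`.
`universalWitnessFamily_of` is this lemma after `captureAt_of_bulkKerrCapture`/`captureAt_zero_of_captureAt`.
[folklore] -/
theorem universalWitnessFamily_of_captureAt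
    (hB : Goal.stub_approxKerrBurial) (hH : Goal.stub_hypersurfaceMGHDRealised)
    (hU : Goal.stub_captureUpgrade) (hS : Goal.stub_softShieldedSettles)
    (hCov : Goal.stub_scaleCovariance) (hE : SwallowTheDatum.MGHDExists)
    (hcap : ∀ [Kerr.Facts] [Kerr.SliceFacts], ∃ (s : ℕ) (δ : ℝ), ∃ ε > (0 : ℝ), ∃ C : ℝ,
      ∀ a : ℝ, |a| ≤ 1 / 2 → CaptureAt s δ 0 1 zero_le_one ε C a) :
    SwallowTheDatum.UniversalWitnessFamily := by
  haveI : Kerr.Facts :=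
    ⟨Kerr.isConnected_region_holds, Kerr.contMDiff_bilin_holds, Kerr.contMDiff_timeVector_holds⟩
  haveI : Kerr.SliceFacts := Kerr.sliceFacts_holds
  obtain ⟨s, δ, ε, hε, C, hC⟩ := @hcap ‹Kerr.Facts› ‹Kerr.SliceFacts›
  have hC2 : ∀ a : ℝ, |a| ≤ 1 / 2 → CaptureAt s δ 2 1 one_pos.le ε C a := fun a ha ↦
    @hU ‹Kerr.Facts› ‹Kerr.SliceFacts› s δ 1 one_pos ε C a (hC a ha)
  intro X i₁ i₂ i₃ i₄ i₅ i₆ d hd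
  obtain ⟨F, hF, h0, hinj, hadm, hshield⟩ :=
    @hB ‹Kerr.Facts› ‹Kerr.SliceFacts› s δ ε hε 1 one_pos X i₁ i₂ i₃ i₄ i₅ i₆ d hd
  refine ⟨F, hF, h0, hinj, hadm, fun c hc ↦ ⟨@hE X i₁ i₂ i₃ i₄ i₅ i₆ (F c) (hadm c), ?_⟩⟩
  obtain ⟨D', lam, a, hlam, ha, hadm', hdil, hsoft⟩ := hshield c hc
  exact hCov X (F c) D' lam hlam hdil
    (@hS hH ‹Kerr.Facts› ‹Kerr.SliceFacts› s δ 1 one_pos ε C a (hC2 a ha) X i₁ i₂ i₃ i₄ i₅ i₆ D'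
      hadm' hsoft)

/-! ## Appendix (A) — the obstruction that forces the design (not a stub; provable real analysis) -/

/-- **OLD LIGHT LOWER BOUND.** For a smooth compactly supported non-zero profile `F`, the outgoing shell
`y ↦ F(‖y‖ − t)/‖y‖` on `E3` has squared weighted Sobolev seminorm at least `c · t^{2(δ+s)}` for all
large `t` (the `s`-th radial derivative is `F^{(s)}(‖y‖ − t)/‖y‖ + O(t⁻²)` on the shell `‖y‖ ≈ t`, where
the weight is `(1 + ‖y‖)^{2(δ+s)} ≍ t^{2(δ+s)}`; numerics: kit j008861, limit `4π‖F^{(s)}‖²`).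
Consequence (the card's audit, confirmed by TRIAGE-r1-2/3 and Disproof §D): if `δ + s > 0` no spacelike
hypersurface through a late near zone of a development that has radiated is `H^s_δ`-close to Kerr slice
data, so the capture hypotheses are consumable only on freshly prepared, globally near-Kerr data — which
is why this line compares on the Kerr–Schild leaf of a softly shielded datum at time zero. (Gen-2 triage
X1′: cone-cut regluing evades the obstruction at the TRUNCATED level for the late-time lines; it does not
touch this line.) [folklore] -/
def OldLightLowerBound : Prop :=
  ∀ (s : ℕ) (δ : ℝ) (F : ℝ → ℝ), ContDiff ℝ (⊤ : ℕ∞) F → HasCompactSupport F → F ≠ 0 →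
    ∃ c > (0 : ℝ), ∃ t₀ : ℝ, ∀ t : ℝ, t₀ ≤ t →
      ENNReal.ofReal (c * t ^ (2 * (δ + s))) ≤
        (weightedSobolevSeminorm (Set.univ : Set E3) s δ (fun y : E3 ↦ F (‖y‖ - t) / ‖y‖)) ^ 2

end Summit.FinalStateConjecture.FinalStateConjecture.Cruxes.CaptureSuffices.OldLightForcesSoftBurial

end
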